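import Mathlib
import Summits.NavierStokesRegularity.NavierStokesRegularity.Theorems.FilamentSkeletonRssClause13FarOperatorSup

/-!
# Clause 13-J/13-R, brick m3b-Fw (FAR OPERATOR BOOKKEEPING AGAINST A WEIGHTED SUP): `‖𝓛Y_H(x)‖` when `‖Y(y)‖ ≤ S·(1+|y−c|/ℓ)^p`

Route `FilamentSkeletonRss`, ∃-side clause 13 (`Clause13RNearStraightL`, stmt-NavierStokesRegularity-23612; typing-agnostic).  Design of record
rev 80–82 (m3b) and lane memo `DESIGN-28296-model-Linfty-g18.md` §3 (m3-w).  `norm_modelOperator_far_le` (p717403) bounds the commutator part of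
`𝓛Y_H` by `c_k·sup‖Y‖`; for the WEIGHTED bootstrap (conclusion in the clause's shape `‖Y(τ)‖ ≤ cnd·(1+|τ−c|/ℓ)^p·(…)`) the sup must be a weighted
one.  With the weight `ω(y) = (1+|y−c|/ℓ)^p`, `0 ≤ p ≤ 1`, `ℓ > 0`:
* §1 `weight_le_weight_mul` — `ω(y) ≤ ω(x)·(1+|x−y|/ℓ)` (triangle inequality + `p ≤ 1`); `integral_kernel_mul_norm_le_weightedSup` —
  `∫K(x−y)‖f(y)‖dy ≤ (‖K‖₁ + ‖tK‖₁/ℓ)·S·ω(x)` when `‖f‖ ≤ S·ω` (one more kernel moment than the flat version);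
* §2 ★ `norm_modelOperator_far_le_weighted` — `‖𝓛Y_H(x)‖ ≤ (1+‖k‖₁)S_L + Λ‖P_T(x)‖ + c_k^ℓ·S·ω(x)` with
  `c_k^ℓ = Λ₂(‖t²k′‖₁ + ‖tk‖₁ + (‖t³k′‖₁ + ‖t²k‖₁)/ℓ) + (L₁+L₂)(‖tk‖₁ + ‖t²k‖₁/ℓ)` (kernel `k` real `C¹`, bounded, `k, tk, t²k, t²k′, t³k′ ∈ L¹`).
Lane ns-filament-19175-p1 g18; `--supports stmt-NavierStokesRegularity-23612 --as helper`.
HONEST FRAMING: bookkeeping about an explicit 1-D model operator attached to a HYPOTHETICAL filament skeleton on the NEGATIVE side of a MODEL route;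
nothing here bears on Navier–Stokes regularity or blow-up; 23610/23612 stay OPEN.
-/

noncomputable section

open MeasureTheory Real Complex Filter Set
open scoped ComplexConjugate Topology

namespace Summit.NavierStokesRegularity.NavierStokesRegularity.Theorems.MatchedKernel
set_option linter.dupNamespace false

/-! ## §1 The weight and the weighted kernel bound -/

/-- **Sub-multiplicativity of the weight**: for `ℓ > 0`, `0 ≤ p ≤ 1`: `(1+|y−c|/ℓ)^p ≤ (1+|x−c|/ℓ)^p·(1+|x−y|/ℓ)`. [folklore] -/
theorem weight_le_weight_mul {ℓ p c : ℝ} (hℓ : 0 < ℓ) (hp0 : 0 ≤ p) (hp1 : p ≤ 1) (x y : ℝ) :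
    (1 + |y - c| / ℓ) ^ p ≤ (1 + |x - c| / ℓ) ^ p * (1 + |x - y| / ℓ) := by
  have h0 : 0 ≤ |x - c| / ℓ := by positivity
  have h1 : 0 ≤ |x - y| / ℓ := by positivity
  have htri : 1 + |y - c| / ℓ ≤ (1 + |x - c| / ℓ) * (1 + |x - y| / ℓ) := by
    have ht : |y - c| ≤ |x - y| + |x - c| := by
      have := abs_sub_le y x c
      rwa [abs_sub_comm y x] at this
    have ht' : |y - c| / ℓ ≤ |x - y| / ℓ + |x - c| / ℓ := by
      rw [← add_div]; exact div_le_div_of_nonneg_right ht hℓ.le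
    nlinarith [mul_nonneg h0 h1]
  have hA : (1 : ℝ) ≤ 1 + |x - y| / ℓ := by linarith
  calc (1 + |y - c| / ℓ) ^ p ≤ ((1 + |x - c| / ℓ) * (1 + |x - y| / ℓ)) ^ p :=
        Real.rpow_le_rpow (by positivity) htri hp0
    _ = (1 + |x - c| / ℓ) ^ p * (1 + |x - y| / ℓ) ^ p := Real.mul_rpow (by positivity) (by positivity)
    _ ≤ (1 + |x - c| / ℓ) ^ p * (1 + |x - y| / ℓ) := by
        refine mul_le_mul_of_nonneg_left ?_ (by positivity)
        have h := Real.rpow_le_rpow_of_exponent_le hA hp1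
        rwa [Real.rpow_one] at h

/-- **Weighted kernel bound**: `K, tK ∈ L¹` real, `f` continuous with `‖f(y)‖ ≤ S·(1+|y−c|/ℓ)^p` (`S ≥ 0`, `0 ≤ p ≤ 1`, `ℓ > 0`); then
`∫K(x−y)‖f(y)‖dy ≤ (‖K‖₁ + ‖tK‖₁/ℓ)·S·(1+|x−c|/ℓ)^p`. [folklore] -/
theorem integral_kernel_mul_norm_le_weightedSup {K : ℝ → ℝ} (hK : Integrable K) (hK1 : Integrable fun t => |t| * |K t|)
    {f : ℝ → ℂ} (hfc : Continuous f) {S ℓ p c : ℝ} (hS : 0 ≤ S) (hℓ : 0 < ℓ) (hp0 : 0 ≤ p) (hp1 : p ≤ 1)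
    (hf : ∀ y, ‖f y‖ ≤ S * (1 + |y - c| / ℓ) ^ p) (x : ℝ) :
    ∫ y : ℝ, K (x - y) * ‖f y‖ ≤ ((∫ t, |K t|) + (∫ t, |t| * |K t|) / ℓ) * S * (1 + |x - c| / ℓ) ^ p := by
  have hω0 : 0 < (1 + |x - c| / ℓ) ^ p := Real.rpow_pos_of_pos (by positivity) _
  -- integrable majorant `|K(x−y)|·(1 + |x−y|/ℓ)·S·ω(x)`
  have hKx : Integrable (fun y : ℝ => K (x - y)) := hK.comp_sub_left x
  have hi1 : Integrable fun y : ℝ => |K (x - y)| := hKx.abs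
  have hi2 : Integrable fun y : ℝ => |x - y| * |K (x - y)| := hK1.comp_sub_left x
  have hmaj : Integrable fun y : ℝ => (|K (x - y)| + |x - y| * |K (x - y)| / ℓ) * (S * (1 + |x - c| / ℓ) ^ p) :=
    (hi1.add (hi2.div_const ℓ)).mul_const _
  -- pointwise bound
  have hpt : ∀ y : ℝ, K (x - y) * ‖f y‖ ≤ (|K (x - y)| + |x - y| * |K (x - y)| / ℓ) * (S * (1 + |x - c| / ℓ) ^ p) := by
    intro y
    have h1 : K (x - y) * ‖f y‖ ≤ |K (x - y)| * ‖f y‖ := mul_le_mul_of_nonneg_right (le_abs_self _) (norm_nonneg _)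
    have h2 : |K (x - y)| * ‖f y‖ ≤ |K (x - y)| * (S * (1 + |y - c| / ℓ) ^ p) := mul_le_mul_of_nonneg_left (hf y) (abs_nonneg _)
    have h3 : S * (1 + |y - c| / ℓ) ^ p ≤ S * ((1 + |x - c| / ℓ) ^ p * (1 + |x - y| / ℓ)) :=
      mul_le_mul_of_nonneg_left (weight_le_weight_mul hℓ hp0 hp1 x y) hS
    have h4 : |K (x - y)| * (S * ((1 + |x - c| / ℓ) ^ p * (1 + |x - y| / ℓ)))
        = (|K (x - y)| + |x - y| * |K (x - y)| / ℓ) * (S * (1 + |x - c| / ℓ) ^ p) := by ring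
    calc K (x - y) * ‖f y‖ ≤ |K (x - y)| * (S * (1 + |y - c| / ℓ) ^ p) := h1.trans h2
      _ ≤ |K (x - y)| * (S * ((1 + |x - c| / ℓ) ^ p * (1 + |x - y| / ℓ))) := mul_le_mul_of_nonneg_left h3 (abs_nonneg _)
      _ = _ := h4
  -- integrability of the left integrand: dominated by the majorant, measurable
  have hL : Integrable (fun y : ℝ => K (x - y) * ‖f y‖) := by
    refine Integrable.mono' hmaj ((hKx.aestronglyMeasurable).mul hfc.norm.aestronglyMeasurable) (ae_of_all _ fun y => ?_)
    rw [Real.norm_eq_abs, abs_mul, abs_of_nonneg (norm_nonneg _)]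
    have h2 : |K (x - y)| * ‖f y‖ ≤ |K (x - y)| * (S * (1 + |y - c| / ℓ) ^ p) := mul_le_mul_of_nonneg_left (hf y) (abs_nonneg _)
    have h3 : S * (1 + |y - c| / ℓ) ^ p ≤ S * ((1 + |x - c| / ℓ) ^ p * (1 + |x - y| / ℓ)) :=
      mul_le_mul_of_nonneg_left (weight_le_weight_mul hℓ hp0 hp1 x y) hS
    calc |K (x - y)| * ‖f y‖ ≤ |K (x - y)| * (S * ((1 + |x - c| / ℓ) ^ p * (1 + |x - y| / ℓ))) :=
          h2.trans (mul_le_mul_of_nonneg_left h3 (abs_nonneg _))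
      _ = (|K (x - y)| + |x - y| * |K (x - y)| / ℓ) * (S * (1 + |x - c| / ℓ) ^ p) := by ring
  have hint := integral_mono hL hmaj hpt
  refine hint.trans (le_of_eq ?_)
  rw [integral_mul_const, integral_add hi1 (hi2.div_const ℓ), integral_div]
  rw [integral_sub_left_eq_self (fun t => |K t|) volume x, integral_sub_left_eq_self (fun t => |t| * |K t|) volume x]
  ring

/-! ## §2 The far operator against the weighted sup -/

/-- ★ **WEIGHTED SUP BOUND FOR `𝓛Y_H`.**  Setting of `norm_modelOperator_far_le` (p717403) with moreover `t²k, t³k′ ∈ L¹`, and the flat bound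
`‖Y‖ ≤ S_Y` replaced by the weighted one `‖Y(y)‖ ≤ S·(1+|y−c|/ℓ)^p` (`S ≥ 0`, `0 ≤ p ≤ 1`, `ℓ > 0`).  Then at every `x`:
`‖𝓛Y_H(x)‖ ≤ (1+‖k‖₁)·S_L + Λ·‖P_T(x)‖ + [Λ₂(‖t²k′‖₁ + ‖tk‖₁ + (‖t³k′‖₁ + ‖t²k‖₁)/ℓ) + (L₁+L₂)(‖tk‖₁ + ‖t²k‖₁/ℓ)]·S·(1+|x−c|/ℓ)^p`. [folklore] -/
theorem norm_modelOperator_far_le_weighted {q G : ℝ} (hq : 0 < q) {k k' : ℝ → ℝ} (hk : ∀ t, HasDerivAt k (k' t) t) (hk'c : Continuous k')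
    (hki : Integrable k) (hk1 : Integrable fun t => t * k t) (hk2 : Integrable fun t => t ^ 2 * k t)
    (hk'2 : Integrable fun t => t ^ 2 * k' t) (hk'3 : Integrable fun t => t ^ 3 * k' t) {Mk : ℝ} (hkM : ∀ t, |k t| ≤ Mk)
    {Y : ℝ → ℂ} (hY : ContDiff ℝ 1 Y) (hYs : HasCompactSupport Y)
    {w : ℝ → ℝ} (hw : Differentiable ℝ w) (hw2 : Differentiable ℝ (deriv w)) {Λ Λ₂ : ℝ} (hΛ : ∀ t, |deriv w t| ≤ Λ)
    (hΛ₂ : ∀ t, |deriv (deriv w) t| ≤ Λ₂)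
    {β₁ β₂ : ℝ → ℂ} (hβ₁c : Continuous β₁) (hβ₂c : Continuous β₂) {b₁ b₂ L₁ L₂ : ℝ}
    (hb₁ : ∀ τ, ‖β₁ τ‖ ≤ b₁) (hb₂ : ∀ τ, ‖β₂ τ‖ ≤ b₂) (hL₁ : ∀ x y, ‖β₁ y - β₁ x‖ ≤ L₁ * |y - x|)
    (hL₂ : ∀ x y, ‖β₂ y - β₂ x‖ ≤ L₂ * |y - x|)
    {SL S ℓ p c : ℝ} (hS : 0 ≤ S) (hℓ : 0 < ℓ) (hp0 : 0 ≤ p) (hp1 : p ≤ 1)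
    (hSL : ∀ y : ℝ, ‖I * (G : ℂ) * ((2 / q : ℂ) * Y y
          - ∫ σ : ℝ, ((((2 * q - (y - σ) ^ 2) * (((y - σ) ^ 2 + q) ^ (5 / 2 : ℝ))⁻¹ : ℝ)) : ℂ) * Y σ)
        - ((w y : ℝ) : ℂ) * deriv Y y + β₁ y * Y y + β₂ y * conj (Y y)‖ ≤ SL)
    (hSY : ∀ y : ℝ, ‖Y y‖ ≤ S * (1 + |y - c| / ℓ) ^ p) (x : ℝ) :
    ‖I * (G : ℂ) * ((2 / q : ℂ) * (Y x - ∫ y : ℝ, ((k (x - y) : ℝ) : ℂ) * Y y)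
          - ∫ σ : ℝ, ((((2 * q - (x - σ) ^ 2) * (((x - σ) ^ 2 + q) ^ (5 / 2 : ℝ))⁻¹ : ℝ)) : ℂ) * (Y σ - ∫ y : ℝ, ((k (σ - y) : ℝ) : ℂ) * Y y))
        - ((w x : ℝ) : ℂ) * (deriv Y x - ∫ y : ℝ, ((k (x - y) : ℝ) : ℂ) * deriv Y y) + β₁ x * (Y x - ∫ y : ℝ, ((k (x - y) : ℝ) : ℂ) * Y y)
        + β₂ x * conj (Y x - ∫ y : ℝ, ((k (x - y) : ℝ) : ℂ) * Y y)‖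
      ≤ (1 + ∫ t, |k t|) * SL + Λ * ‖∫ y : ℝ, (((x - y) * k' (x - y) + k (x - y) : ℝ) : ℂ) * Y y‖
        + (Λ₂ * (((∫ t, t ^ 2 * |k' t|) + (∫ t, |t| * |k t|)) + ((∫ t, |t| ^ 3 * |k' t|) + (∫ t, t ^ 2 * |k t|)) / ℓ)
            + (L₁ + L₂) * ((∫ t, |t| * |k t|) + (∫ t, t ^ 2 * |k t|) / ℓ)) * S * (1 + |x - c| / ℓ) ^ p := by
  have hkc : Continuous k := continuous_iff_continuousAt.2 fun t => (hk t).continuousAt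
  have hYc := hY.continuous
  rw [modelOperator_far_eq (G := G) hq hk hk'c hki hkM hY hYs hw hw2 hΛ hβ₁c hβ₂c hb₁ hb₂ x]
  -- names
  set LY : ℝ → ℂ := fun y => I * (G : ℂ) * ((2 / q : ℂ) * Y y
          - ∫ σ : ℝ, ((((2 * q - (y - σ) ^ 2) * (((y - σ) ^ 2 + q) ^ (5 / 2 : ℝ))⁻¹ : ℝ)) : ℂ) * Y σ)
        - ((w y : ℝ) : ℂ) * deriv Y y + β₁ y * Y y + β₂ y * conj (Y y) with hLY
  set A : ℂ := ∫ y : ℝ, ((k (x - y) : ℝ) : ℂ) * LY y with hA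
  set PT : ℂ := ∫ y : ℝ, (((x - y) * k' (x - y) + k (x - y) : ℝ) : ℂ) * Y y with hPT
  set Rm : ℂ := ∫ y : ℝ, ((k' (x - y) * (w y - w x - deriv w x * (y - x)) - k (x - y) * (deriv w y - deriv w x) : ℝ) : ℂ) * Y y with hRm
  set M1 : ℂ := ∫ y, ((k (x - y) : ℝ) : ℂ) * (β₁ y - β₁ x) * Y y with hM1
  set M2 : ℂ := ∫ y, ((k (x - y) : ℝ) : ℂ) * (β₂ y - β₂ x) * conj (Y y) with hM2
  set ω : ℝ := (1 + |x - c| / ℓ) ^ p with hω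
  have hω0 : 0 < ω := Real.rpow_pos_of_pos (by positivity) _
  -- nonnegativity facts
  have hL1 : 0 ≤ L₁ := by
    have := hL₁ 0 1; rw [sub_zero, abs_one, mul_one] at this; exact (norm_nonneg _).trans this
  have hL2 : 0 ≤ L₂ := by
    have := hL₂ 0 1; rw [sub_zero, abs_one, mul_one] at this; exact (norm_nonneg _).trans this
  have hΛ20 : 0 ≤ Λ₂ := (abs_nonneg _).trans (hΛ₂ 0)
  -- moment integrability in `| · |` form
  have hi1 : Integrable fun t => |t| * |k t| := by
    refine hk1.abs.congr (ae_of_all _ fun t => ?_); simp only [abs_mul]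
  have hi2 : Integrable fun t => t ^ 2 * |k' t| := by
    refine hk'2.abs.congr (ae_of_all _ fun t => ?_); simp only [abs_mul, abs_pow, sq_abs]
  have hi2k : Integrable fun t => t ^ 2 * |k t| := by
    refine hk2.abs.congr (ae_of_all _ fun t => ?_); simp only [abs_mul, abs_pow, sq_abs]
  have hi3 : Integrable fun t => |t| ^ 3 * |k' t| := by
    refine hk'3.abs.congr (ae_of_all _ fun t => ?_); simp only [abs_mul, abs_pow]
  -- the bounds
  have h0 : ‖LY x‖ ≤ SL := hSL x
  have h1 : ‖A‖ ≤ (∫ t, |k t|) * SL := norm_integral_kernel_mul_le_sup hki hSL x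
  have h2 : ‖((deriv w x : ℝ) : ℂ) * PT‖ ≤ Λ * ‖PT‖ := by
    rw [norm_mul, Complex.norm_real, Real.norm_eq_abs]
    exact mul_le_mul_of_nonneg_right (hΛ x) (norm_nonneg _)
  have h3 : ‖Rm‖ ≤ (Λ₂ * ((∫ t, t ^ 2 * |k' t|) + (∫ t, |t| * |k t|)) + Λ₂ * ((∫ t, |t| ^ 3 * |k' t|) + (∫ t, t ^ 2 * |k t|)) / ℓ)
      * S * ω := by
    have hdom := norm_transportCommutatorRemainder_le hk hk'c hw hw2 hΛ₂ hYc hYs x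
    set K : ℝ → ℝ := fun t => Λ₂ * (t ^ 2 * |k' t| + |t| * |k t|) with hK
    have hKi : Integrable K := (hi2.add hi1).const_mul Λ₂
    have hKnn : ∀ t, 0 ≤ K t := fun t => by positivity
    have hK1 : Integrable fun t => |t| * |K t| := by
      have h : Integrable fun t => Λ₂ * (|t| ^ 3 * |k' t| + t ^ 2 * |k t|) := (hi3.add hi2k).const_mul Λ₂
      refine h.congr (ae_of_all _ fun t => ?_)
      show Λ₂ * (|t| ^ 3 * |k' t| + t ^ 2 * |k t|) = |t| * |K t|
      rw [abs_of_nonneg (hKnn t)]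
      simp only [hK]
      rw [← sq_abs t]
      ring
    have hsup := integral_kernel_mul_norm_le_weightedSup hKi hK1 hYc hS hℓ hp0 hp1 hSY x
    have hKabs : ∫ t, |K t| = Λ₂ * ((∫ t, t ^ 2 * |k' t|) + ∫ t, |t| * |k t|) := by
      have habs : (fun t => |K t|) = fun t => Λ₂ * (t ^ 2 * |k' t| + |t| * |k t|) :=
        funext fun t => abs_of_nonneg (hKnn t)
      rw [habs, integral_const_mul, integral_add hi2 hi1]
    have hKabs1 : ∫ t, |t| * |K t| = Λ₂ * ((∫ t, |t| ^ 3 * |k' t|) + ∫ t, t ^ 2 * |k t|) := by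
      have habs : (fun t => |t| * |K t|) = fun t => Λ₂ * (|t| ^ 3 * |k' t| + t ^ 2 * |k t|) := by
        funext t
        rw [abs_of_nonneg (hKnn t)]
        simp only [hK]
        rw [← sq_abs t]
        ring
      rw [habs, integral_const_mul, integral_add hi3 hi2k]
    have e : (fun y : ℝ => K (x - y) * ‖Y y‖) = fun y => (Λ₂ * ((x - y) ^ 2 * |k' (x - y)| + |x - y| * |k (x - y)|)) * ‖Y y‖ := rfl
    rw [e, hKabs, hKabs1] at hsup
    exact hdom.trans hsup
  have h4 : ‖M1‖ ≤ (L₁ * (∫ t, |t| * |k t|) + L₁ * (∫ t, t ^ 2 * |k t|) / ℓ) * S * ω := by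
    have hdom := norm_multiplierCommutator_le hkc hL₁ hYc hYs x
    set K : ℝ → ℝ := fun t => L₁ * (|t| * |k t|) with hK
    have hKi : Integrable K := hi1.const_mul L₁
    have hKnn : ∀ t, 0 ≤ K t := fun t => by positivity
    have hK1 : Integrable fun t => |t| * |K t| := by
      refine (hi2k.const_mul L₁).congr (ae_of_all _ fun t => ?_)
      show L₁ * (t ^ 2 * |k t|) = |t| * |K t|
      rw [abs_of_nonneg (hKnn t)]
      simp only [hK]
      rw [← sq_abs t]
      ring
    have hsup := integral_kernel_mul_norm_le_weightedSup hKi hK1 hYc hS hℓ hp0 hp1 hSY x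
    have hKabs : ∫ t, |K t| = L₁ * ∫ t, |t| * |k t| := by
      have habs : (fun t => |K t|) = fun t => L₁ * (|t| * |k t|) := funext fun t => abs_of_nonneg (hKnn t)
      rw [habs, integral_const_mul]
    have hKabs1 : ∫ t, |t| * |K t| = L₁ * ∫ t, t ^ 2 * |k t| := by
      have habs : (fun t => |t| * |K t|) = fun t => L₁ * (t ^ 2 * |k t|) := by
        funext t; rw [abs_of_nonneg (hKnn t)]; simp only [hK]
        rw [← sq_abs t]
        ring
      rw [habs, integral_const_mul]
    have e : (fun y : ℝ => K (x - y) * ‖Y y‖) = fun y => (L₁ * (|x - y| * |k (x - y)|)) * ‖Y y‖ := rfl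
    rw [e, hKabs, hKabs1] at hsup
    exact hdom.trans hsup
  have h5 : ‖M2‖ ≤ (L₂ * (∫ t, |t| * |k t|) + L₂ * (∫ t, t ^ 2 * |k t|) / ℓ) * S * ω := by
    have hYcc : Continuous fun y => conj (Y y) := Complex.continuous_conj.comp hYc
    have hYcs : HasCompactSupport fun y => conj (Y y) := hYs.comp_left (g := conj) (map_zero _)
    have hdom := norm_multiplierCommutator_le (f := fun y => conj (Y y)) hkc hL₂ hYcc hYcs x
    set K : ℝ → ℝ := fun t => L₂ * (|t| * |k t|) with hK
    have hKi : Integrable K := hi1.const_mul L₂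
    have hKnn : ∀ t, 0 ≤ K t := fun t => by positivity
    have hK1 : Integrable fun t => |t| * |K t| := by
      refine (hi2k.const_mul L₂).congr (ae_of_all _ fun t => ?_)
      show L₂ * (t ^ 2 * |k t|) = |t| * |K t|
      rw [abs_of_nonneg (hKnn t)]
      simp only [hK]
      rw [← sq_abs t]
      ring
    have hSY' : ∀ y : ℝ, ‖conj (Y y)‖ ≤ S * (1 + |y - c| / ℓ) ^ p := fun y => by rw [Complex.norm_conj]; exact hSY y
    have hsup := integral_kernel_mul_norm_le_weightedSup hKi hK1 hYcc hS hℓ hp0 hp1 hSY' x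
    have hKabs : ∫ t, |K t| = L₂ * ∫ t, |t| * |k t| := by
      have habs : (fun t => |K t|) = fun t => L₂ * (|t| * |k t|) := funext fun t => abs_of_nonneg (hKnn t)
      rw [habs, integral_const_mul]
    have hKabs1 : ∫ t, |t| * |K t| = L₂ * ∫ t, t ^ 2 * |k t| := by
      have habs : (fun t => |t| * |K t|) = fun t => L₂ * (t ^ 2 * |k t|) := by
        funext t; rw [abs_of_nonneg (hKnn t)]; simp only [hK]
        rw [← sq_abs t]
        ring
      rw [habs, integral_const_mul]
    have e : (fun y : ℝ => K (x - y) * ‖conj (Y y)‖) = fun y => (L₂ * (|x - y| * |k (x - y)|)) * ‖conj (Y y)‖ := rfl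
    rw [e, hKabs, hKabs1] at hsup
    exact hdom.trans hsup
  -- triangle inequality
  calc ‖(((((LY x - A) + ((deriv w x : ℝ) : ℂ) * PT) - Rm) + M1) + M2)‖
      ≤ ‖LY x‖ + ‖A‖ + ‖((deriv w x : ℝ) : ℂ) * PT‖ + ‖Rm‖ + ‖M1‖ + ‖M2‖ := by
        have t1 := norm_sub_le (LY x) A
        have t2 := norm_add_le (LY x - A) (((deriv w x : ℝ) : ℂ) * PT)
        have t3 := norm_sub_le ((LY x - A) + ((deriv w x : ℝ) : ℂ) * PT) Rm
        have t4 := norm_add_le (((LY x - A) + ((deriv w x : ℝ) : ℂ) * PT) - Rm) M1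
        have t5 := norm_add_le ((((LY x - A) + ((deriv w x : ℝ) : ℂ) * PT) - Rm) + M1) M2
        linarith
    _ ≤ SL + (∫ t, |k t|) * SL + Λ * ‖PT‖
          + (Λ₂ * ((∫ t, t ^ 2 * |k' t|) + (∫ t, |t| * |k t|)) + Λ₂ * ((∫ t, |t| ^ 3 * |k' t|) + (∫ t, t ^ 2 * |k t|)) / ℓ) * S * ω
          + (L₁ * (∫ t, |t| * |k t|) + L₁ * (∫ t, t ^ 2 * |k t|) / ℓ) * S * ω
          + (L₂ * (∫ t, |t| * |k t|) + L₂ * (∫ t, t ^ 2 * |k t|) / ℓ) * S * ω := by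
        linarith
    _ = _ := by simp only [hω]; ring

end Summit.NavierStokesRegularity.NavierStokesRegularity.Theorems.MatchedKernel

end
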